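import Mathlib.NumberTheory.Padics.RingHoms
import Mathlib.Topology.Algebra.Group.Basic
import HarnessLib

/-!
# Additive endomorphisms of `ℤ_p` and of `∏_p ℤ_p = Ẑ` are multiplications

Two elementary facts about the profinite ring `Ẑ = ∏_p ℤ_p` that are used when a "cyclotome"
`M ≅ Ẑ` is compared with its ℤ-bidual `Hom_ℤ(Hom(M, Ẑ), Ẑ)` ([AbsTopIII] Prop. 1.4 (ii):
`M_X := Hom(H²(Δ_X, Ẑ), Ẑ)` with `H²(Δ_X, Ẑ) ≅ Ẑ`): every ADDITIVE map `ℤ_p → ℤ_p` is `x ↦ x · f(1)`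
(it preserves `p^k ℤ_p`, hence is continuous, and agrees with `x ↦ x f(1)` on the dense subgroup `ℤ`),
and the same holds for the product over all primes (an additive map `∏_p ℤ_p → ℤ_ℓ` kills the
elements with vanishing `ℓ`-component, these being `ℓ`-divisible to all orders).  Consequently
`End_ℤ(Ẑ) = Ẑ` and every additive endomorphism of `Ẑ` is continuous and `Ẑ`-linear.
These are the cases `G = ℤ_p`, `G = Ẑ` of the continuity of abstract homomorphisms out of
(topologically) finitely generated profinite groups [cite: NikolovSegal2003, Thm 1.1] (every subgroup of
finite index is open), proved here directly and elementarily; cf. Fuchs, *Infinite Abelian Groups* I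
§39 (`Hom(J_p, J_p) ≅ J_p`).
-/

noncomputable section

open scoped Classical

namespace Literature.Algebra.Module.PadicProductEnd

/-! ### One prime -/

section OnePrime

variable {p : ℕ} [Fact p.Prime]

/-- An additive map `ℤ_p → ℤ_p` maps `p^k ℤ_p` into `p^k ℤ_p`. [folklore] -/
private theorem norm_map_le_of_norm_le (f : ℤ_[p] →+ ℤ_[p]) (k : ℕ) {x : ℤ_[p]}
    (hx : ‖x‖ ≤ (p : ℝ) ^ (-(k : ℤ))) : ‖f x‖ ≤ (p : ℝ) ^ (-(k : ℤ)) := by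
  rw [PadicInt.norm_le_pow_iff_mem_span_pow] at hx ⊢
  obtain ⟨y, rfl⟩ := Ideal.mem_span_singleton'.mp hx
  have h1 : y * (p : ℤ_[p]) ^ k = (p ^ k : ℕ) • y := by
    rw [nsmul_eq_mul, Nat.cast_pow, mul_comm]
  rw [h1, map_nsmul, nsmul_eq_mul, Nat.cast_pow]
  exact Ideal.mem_span_singleton'.mpr ⟨f y, by ring⟩

/-- **Every additive map `ℤ_p → ℤ_p` is continuous** — the case `G = ℤ_p` of "in a (topologically)
finitely generated profinite group every subgroup of finite index is open", whence every abstract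
homomorphism to a profinite group is continuous; proved here directly (`f(p^k ℤ_p) ⊆ p^k ℤ_p`).
[cite: NikolovSegal2003, Thm 1.1] -/
theorem continuous_addMonoidHom (f : ℤ_[p] →+ ℤ_[p]) : Continuous f := by
  apply continuous_of_continuousAt_zero f
  rw [ContinuousAt, map_zero, Metric.tendsto_nhds_nhds]
  intro ε hε
  obtain ⟨k, hk⟩ := PadicInt.exists_pow_neg_lt p hε
  refine ⟨(p : ℝ) ^ (-(k : ℤ)), zpow_pos (by exact_mod_cast (Fact.out : p.Prime).pos) _,
    fun {x} hx => ?_⟩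
  rw [dist_zero_right] at hx ⊢
  exact lt_of_le_of_lt (norm_map_le_of_norm_le f k hx.le) hk

/-- **Every additive map `ℤ_p → ℤ_p` is multiplication by `f 1`** (continuity, loc. cit., plus density
of `ℤ`; i.e. `End_ℤ(ℤ_p) = ℤ_p`). [cite: NikolovSegal2003, Thm 1.1] -/
theorem addMonoidHom_apply_eq_mul (f : ℤ_[p] →+ ℤ_[p]) (x : ℤ_[p]) : f x = x * f 1 := by
  have h1 : Continuous f := continuous_addMonoidHom f
  have h2 : Continuous (fun x : ℤ_[p] => x * f 1) := continuous_id.mul continuous_const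
  refine congr_fun (PadicInt.denseRange_intCast.equalizer h1 h2 ?_) x
  funext n
  change f (n : ℤ_[p]) = (n : ℤ_[p]) * f 1
  rw [← zsmul_one, map_zsmul, zsmul_eq_mul, zsmul_one]

/-- An element lying in `p^k ℤ_p` for every `k` is zero. [folklore] -/
private theorem eq_zero_of_forall_norm_le {z : ℤ_[p]} (hz : ∀ k : ℕ, ‖z‖ ≤ (p : ℝ) ^ (-(k : ℤ))) : z = 0 := by
  by_contra h
  have hpos : 0 < ‖z‖ := norm_pos_iff.mpr h
  obtain ⟨k, hk⟩ := PadicInt.exists_pow_neg_lt p hpos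
  exact absurd (hz k) (not_le.mpr hk)

/-- A prime `ℓ ≠ p` is a unit of `ℤ_p`. [folklore] -/
private theorem isUnit_natCast_of_prime_ne {ℓ : ℕ} (hℓ : ℓ.Prime) (hne : ℓ ≠ p) : IsUnit (ℓ : ℤ_[p]) := by
  rw [PadicInt.isUnit_iff]
  refine le_antisymm (PadicInt.norm_le_one _) (not_lt.mp fun hlt => ?_)
  have hlt' : ‖((ℓ : ℤ) : ℤ_[p])‖ < 1 := by simpa using hlt
  rw [PadicInt.norm_int_lt_one_iff_dvd] at hlt'
  have hdvd : p ∣ ℓ := by exact_mod_cast hlt'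
  exact hne (((Nat.prime_dvd_prime_iff_eq (Fact.out : p.Prime) hℓ).mp hdvd).symm)

end OnePrime

/-! ### The product over all primes -/

section Product

/-- `ℤ_p` for a prime `p : Nat.Primes` (supplying the `Fact` instance). [folklore] -/
abbrev Zp (p : Nat.Primes) : Type := @PadicInt (p : ℕ) ⟨p.2⟩

/-- `Ẑ = ∏_p ℤ_p` as a product ring. [folklore] -/
abbrev PiZp : Type := ∀ p : Nat.Primes, Zp p

/-- In the product, an element with vanishing `ℓ`-component is divisible by every power of `ℓ`.
[folklore] -/
private theorem exists_eq_nsmul_of_apply_eq_zero (x : PiZp) (ℓ : Nat.Primes) (hx : x ℓ = 0) (k : ℕ) :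
    ∃ y : PiZp, x = ((ℓ : ℕ) ^ k) • y := by
  classical
  have hu : ∀ q : Nat.Primes, q ≠ ℓ → IsUnit ((ℓ : ℕ) : Zp q) := fun q hq =>
    @isUnit_natCast_of_prime_ne (q : ℕ) ⟨q.2⟩ (ℓ : ℕ) ℓ.2 (fun h => hq (Subtype.ext h).symm)
  refine ⟨fun q => if hq : q = ℓ then 0 else ((hu q hq).unit⁻¹ : (Zp q)ˣ) ^ k * x q, funext fun q => ?_⟩
  by_cases hq : q = ℓ
  · subst hq
    simp [hx]
  · rw [Pi.smul_apply, dif_neg hq, nsmul_eq_mul, Nat.cast_pow, ← mul_assoc, ← mul_pow,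
      IsUnit.mul_val_inv, one_pow, one_mul]

/-- An additive map `∏_p ℤ_p → ℤ_ℓ` kills every element with vanishing `ℓ`-component. [folklore] -/
private theorem apply_eq_zero_of_apply_eq_zero (ℓ : Nat.Primes) (f : PiZp →+ Zp ℓ) (x : PiZp)
    (hx : x ℓ = 0) : f x = 0 := by
  apply @eq_zero_of_forall_norm_le (ℓ : ℕ) ⟨ℓ.2⟩
  intro k
  obtain ⟨y, rfl⟩ := exists_eq_nsmul_of_apply_eq_zero x ℓ hx k
  rw [map_nsmul, nsmul_eq_mul, Nat.cast_pow,
    @PadicInt.norm_le_pow_iff_mem_span_pow (ℓ : ℕ) ⟨ℓ.2⟩]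
  exact Ideal.mem_span_singleton'.mpr ⟨f y, by ring⟩

/-- **Every additive map `∏_p ℤ_p → ∏_p ℤ_p` is multiplication by `f 1`** — in particular it is
`Ẑ`-linear and continuous, and `End_ℤ(Ẑ) ≅ Ẑ` (the case `G = Ẑ` of loc. cit., proved directly:
additive maps `∏_p ℤ_p → ℤ_ℓ` kill the `ℓ`-divisible elements with zero `ℓ`-component). [cite: NikolovSegal2003, Thm 1.1] -/
theorem addMonoidHom_pi_apply_eq_mul (f : PiZp →+ PiZp) (x : PiZp) : f x = x * f 1 := by
  funext ℓ
  -- the `ℓ`-component of `f`, and its restriction along the `ℓ`-th inclusion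
  let fℓ : PiZp →+ Zp ℓ := (Pi.evalAddMonoidHom (fun p => Zp p) ℓ).comp f
  let g : Zp ℓ →+ Zp ℓ := fℓ.comp (AddMonoidHom.single (fun p => Zp p) ℓ)
  have hsplit : ∀ z : PiZp, fℓ z = g (z ℓ) := by
    intro z
    have hz : z = Pi.single ℓ (z ℓ) + (z - Pi.single ℓ (z ℓ)) := by abel
    have h0 : (z - Pi.single ℓ (z ℓ)) ℓ = 0 := by simp
    calc fℓ z = fℓ (Pi.single ℓ (z ℓ)) + fℓ (z - Pi.single ℓ (z ℓ)) := by
            conv_lhs => rw [hz]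
            rw [map_add]
      _ = g (z ℓ) := by rw [apply_eq_zero_of_apply_eq_zero ℓ fℓ _ h0, add_zero]; rfl
  have hg : g (x ℓ) = x ℓ * g 1 := @addMonoidHom_apply_eq_mul (ℓ : ℕ) ⟨ℓ.2⟩ g (x ℓ)
  calc (f x) ℓ = fℓ x := rfl
    _ = g (x ℓ) := hsplit x
    _ = x ℓ * g 1 := hg
    _ = x ℓ * fℓ 1 := by rw [hsplit 1, Pi.one_apply]
    _ = (x * f 1) ℓ := rfl

/-- **`End_ℤ(Ẑ) = Ẑ`**: evaluation at `1` is an additive bijection from the additive endomorphisms of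
`∏_p ℤ_p` onto `∏_p ℤ_p`, with inverse `c ↦ (x ↦ x c)`. [cite: NikolovSegal2003, Thm 1.1] -/
def addMonoidEndEquiv : (PiZp →+ PiZp) ≃+ PiZp where
  toFun f := f 1
  invFun c := AddMonoidHom.mulRight c
  left_inv f := by
    apply AddMonoidHom.ext
    intro x
    rw [AddMonoidHom.mulRight_apply, ← addMonoidHom_pi_apply_eq_mul]
  right_inv c := by simp
  map_add' f g := rfl

/-- Every additive endomorphism of `∏_p ℤ_p` is continuous (abstract homomorphisms between these
profinite groups are continuous). [cite: NikolovSegal2003, Thm 1.1] -/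
theorem continuous_addMonoidHom_pi (f : PiZp →+ PiZp) : Continuous f := by
  have : (f : PiZp → PiZp) = fun x => x * f 1 := funext (addMonoidHom_pi_apply_eq_mul f)
  rw [this]
  exact continuous_id.mul continuous_const

end Product

end Literature.Algebra.Module.PadicProductEnd
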